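import Summits.Langlands.Langlands.Theses.MonomialConverse

/-!
# Birth skeleton (BC3) for crux stmt-Langlands-18582
`Summit.Langlands.Langlands.Theses.MonomialConverse.HeckeNiceBridge` — line `birth`

THE CRUX (a binder `hB` of the route's deciding theorem `MonomialConverse.closes`):
`HeckeNiceBridge := CPSConverseGL1 → MonomialInduction` — the theorem-level bridge "C ⇒ C₀": the
Cogdell–Piatetski-Shapiro GL₁-twist converse conjecture (analytic form over the tree's carrier
`TwistedStandardLData`) implies automorphic induction of ABELIAN-FREE characters `λ` of `Γ_K` along an
arbitrary finite extension `K/F` (the cuspidal pieces of `Π(Ind_K^F λ)` with the induced Frobenius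
polynomials at almost every place).

THE LINE (= the route's own declared decomposition, items stmt-Langlands-18973 / -18974, filed by the
2026-08-17 cone repair; modus ponens checked by refuter-rreview-0817T02-12-0, crux-attack
refuter-rattack-stmt-Langlands-18582-0: SURVIVES, no cheap collapse):

* STUB 1 = item stmt-Langlands-18973 `HeckeLambdaNice` (BY NAME) — the ANALYTIC INPUT: Hecke 1920 /
  Tate 1950 (Thm 4.4.1) for UNITARY Hecke characters `χ` of a number field `K` that are not norm
  twists (infinite order allowed), in Cogdell–Piatetski-Shapiro currency: `∃ A ∈ ℕ_{>0}`, archimedean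
  shifts `a a'`, `‖W‖ = 1`, ENTIRE `Λ, Λ'` BOUNDED IN VERTICAL STRIPS with `Λ = γ_a · L(χ, ·)`,
  `Λ' = γ_{a'} · L(χ⁻¹, ·)` on `Re s > 1` and `Λ(s) = W · A^{1/2−s} · Λ'(1−s)`.  True in print; in the
  tree it refines the one unproved named fact of the route's import cone,
  `Literature.NumberTheory.GaloisRepresentations.heckeLFunction_functional_equation` (finite-order case
  proved: `heckeLFunction_functional_equation_of_isFiniteOrder`; entire continuation:
  `heckeLFunction_hasEntireContinuation_of_not_isNormTwist_holds`), adding `A ∈ ℕ`, entire `Λ` and the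
  vertical-strip bound (Godement–Jacquet Thm 13.8 at `n = 1`).  Size: XL as a formalisation (Tate's
  thesis for Größencharaktere of infinite order), no truth risk.
* STUB 2 = item stmt-Langlands-18974 `HeckeNiceBridgeOfLambda` (BY NAME) — the FORMAL REMAINDER
  `HeckeLambdaNice → CPSConverseGL1 → MonomialInduction`: for `K/F` finite, `N = [K:F]`, `λ` not the
  restriction of a character of `Γ_F`, build the datum `D : TwistedStandardLData N F` of `Π(Ind_K^F λ)`
  (`α v` = the `N` roots of `∏_{w∣v}(X^{f_w} − λ(Frob_w))`, central character via
  `artinReciprocity_character_holds`, twisted local factors `∏_{w∣v}(1 − ψ(ϖ_w) X^{f_w})` with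
  `ψ = λ·(ω∘N_{K/F})` never a norm twist by abelian-freeness, Γ-shifts regrouped along `w ∣ v`,
  `ε = W·A^{1/2−s}`), get `D.AllTwistsNice` from STUB 1, apply the conjecture, and turn the automorphic
  `P` with the induced Satake family a.e. into unitary cuspidal data (Langlands' constituent-of-induced
  lemma, Corvallis 1979 Prop. 2; Jacquet–Shalika 1981 II Thm 4.4; `|roots of unity| = 1`).  Size: L.

Composition `HeckeNiceBridge_of : STUB 1 → STUB 2 → HeckeNiceBridge` is modus ponens (kernel-checked,
no `sorry` outside the two `stub_*`), concluding the route decl BY NAME.  The seam is trivial BY DESIGN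
(bridge split `T ∧ (T → X)` with `T = HeckeLambdaNice` substantive and open in the tree); neither stub
gives the crux or the summit on its own (BC3 probes `stub → HeckeNiceBridge`, `stub → Langlands` by
`first | exact? | simpa | aesop` all FAIL — see `Lines/birth.md`).  Converse direction, for the record:
`HeckeNiceBridge → HeckeNiceBridgeOfLambda` holds trivially (`fun h _ => h`), i.e. STUB 2 is the crux
weakened by exactly the analytic input, and STUB 1 is independent of the crux.

Disproof used: none — no `Cruxes/HeckeNiceBridge/Disproof.lean` has been filed for this crux
(`ledger crux ls stmt-Langlands-18582`: no workfiles, 2026-08-17); no `_false_without_` obstruction or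
landed Negative lemma exists to honour.  The crux-attack note (rattack, 2026-08-17T05:07Z) records that
abelian-freeness is load-bearing (dropping it gives a `ζ_K`-pole at `ω = χ⁻¹`): honoured — it is a
hypothesis of `MonomialInduction`, consumed inside STUB 2 to exclude norm twists.
-/

-- `Summit.Langlands.Langlands.…` repeats a namespace component by design (D-0017 nested layout).
set_option linter.dupNamespace false

namespace Summit.Langlands.Langlands.Cruxes.HeckeNiceBridge.Birth

open Summit.Langlands.Langlands.Theses.MonomialConverse

/-! ## 1. The open stubs (each IS a route item, by name) -/

/-- **STUB 1 = item stmt-Langlands-18973 (`MonomialConverse.HeckeLambdaNice`), by name.**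
Hecke 1920 / Tate Thm 4.4.1 in Cogdell–Piatetski-Shapiro currency: for every number field `K` and every
unitary Hecke character `χ` of `K` that is not a norm twist there are `A ∈ ℕ_{>0}`, shifts `a a'`,
`‖W‖ = 1` and entire `Λ, Λ'` bounded in vertical strips with `Λ = γ_a · L(χ, ·)`,
`Λ' = γ_{a'} · L(χ⁻¹, ·)` on `Re s > 1` and `Λ(s) = W · A^{1/2−s} · Λ'(1−s)`.  The analytic input of
the bridge; refines the unproved cone fact `heckeLFunction_functional_equation` (infinite-order unitary
case = Tate's adelic functional equation; strips bound = Godement–Jacquet 1972 Thm 13.8, `n = 1`; Hecke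
1920; Neukirch VII (8.6)). [cite: TateThesis1967, Thm 4.4.1] -/
theorem stub_item18973_heckeLambdaNice : HeckeLambdaNice := by
  sorry

/-- **STUB 2 = item stmt-Langlands-18974 (`MonomialConverse.HeckeNiceBridgeOfLambda`), by name.**
`HeckeLambdaNice → CPSConverseGL1 → MonomialInduction`: the formal remainder of the bridge — the datum
`D : TwistedStandardLData [K:F] F` of `Π(Ind_K^F λ)` for abelian-free `λ` (Satake family = roots of the
induced Frobenius polynomials, central character by `artinReciprocity_character_holds`, GL₁-twisted
local factors and Γ-shifts regrouped along `w ∣ v`, `ε = W·A^{1/2−s}`), `D.AllTwistsNice` from STUB 1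
(abelian-freeness ⇒ no twist `λ·(ω∘N_{K/F})` is a norm twist), the conjecture applied at
`N = [K:F]`, and the passage from the automorphic `P` with the induced Satake family a.e. to unitary
cuspidal data (Langlands' constituent-of-induced lemma, Corvallis 1979 Prop. 2; Jacquet–Shalika 1981 II
Thm 4.4; unit modulus of roots of unity). [cite: CogdellPiatetskishapiro1994, p. 166] -/
theorem stub_item18974_heckeNiceBridgeOfLambda : HeckeNiceBridgeOfLambda := by
  sorry

/-! ## 2. The composition (kernel-checked, no `sorry`): modus ponens → the crux BY NAME -/

/-- **`HeckeNiceBridge` from the two stubs.**  `HeckeNiceBridgeOfLambda` unfolds to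
`HeckeLambdaNice → CPSConverseGL1 → MonomialInduction` and `HeckeNiceBridge` to
`CPSConverseGL1 → MonomialInduction`; feeding STUB 1 to STUB 2 is the crux.  Hypotheses are the two
route items by name; conclusion is the route decl by name. [folklore] -/
theorem HeckeNiceBridge_of (hΛ : HeckeLambdaNice) (hB : HeckeNiceBridgeOfLambda) :
    Summit.Langlands.Langlands.Theses.MonomialConverse.HeckeNiceBridge :=
  fun hC => hB hΛ hC

/-- By-name sanity check (an `example`, not a declaration of the file): the open stubs feed the
composition as they stand. -/
example : Summit.Langlands.Langlands.Theses.MonomialConverse.HeckeNiceBridge :=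
  HeckeNiceBridge_of stub_item18973_heckeLambdaNice stub_item18974_heckeNiceBridgeOfLambda

end Summit.Langlands.Langlands.Cruxes.HeckeNiceBridge.Birth
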